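import Literature.Topology.FourManifolds.Morse
import Literature.Topology.FourManifolds.SPC4Handles
import Literature.Topology.FourManifolds.MorseChartChange
import Literature.Topology.FourManifolds.MorseHeightFunctions
import Mathlib.Analysis.Calculus.FDeriv.Symmetric
import Mathlib.Geometry.Manifold.WhitneyEmbedding
import Mathlib.Geometry.Manifold.ContMDiff.Atlas
import Mathlib.Geometry.Manifold.MFDeriv.Atlas
import HarnessLib

/-!
# Existence of Morse functions on closed manifolds (discharge of `Literature.Topology.FourManifolds.exists_isMorse`)

Topic `Literature/Topology/FourManifolds` (trunk FourManL, notion `kirby_calculus_handles`);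
rung **E** of the DAG of the fact item `provefact-Literature.SPC4.exists_isMorse_isSelfIndexing`,
final step.  Everything in this file is **proved**; the main result is the discharge
`Literature.Topology.FourManifolds.exists_isMorse_holds` of the named fact `Literature.SPC4.exists_isMorse n` of
`SPC4Handles.lean` (*every closed smooth `n`-manifold carries a Morse function*; Morse 1934;
Milnor, *Morse theory* (1963), Cor. 6.7; Matsumoto (2001), Thm. 2.20).

Proof (Guillemin–Pollack, *Differential topology* (1974), Ch. 1 §7: almost every height
function is a Morse function): embed the compact manifold `M` in some `ℝᴺ` (Whitney; Mathlib's
`exists_embedding_euclidean_of_compact`), cover `M` by finitely many charts, and read the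
embedding in each chart as an immersion `g` of an open subset of `ℝⁿ`; by
`MorseHeightFunctions.lean`, for almost every `a ∈ ℝᴺ` every critical point of `⟪a, g⟫` in
each of these finitely many charts is nondegenerate; a null set does not exhaust `ℝᴺ`, and for
a good `a` the height function `x ↦ ⟪a, e x⟫` is a Morse function on `M`: being critical and
being nondegenerate are read in any chart (`MorseChartChange.lean`), and an injective
symmetric second derivative is a nondegenerate Hessian.

## References

* V. Guillemin, A. Pollack, *Differential topology* (1974; AMS Chelsea 2010), Ch. 1 §7.
  [GuilleminPollack2010]
* J. Milnor, *Morse theory*, Ann. of Math. Studies 51 (1963), §6, Cor. 6.7. [Milnor1963]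
* Y. Matsumoto, *An introduction to Morse theory* (2001), Thm. 2.20, Lemma 2.21. [Matsumoto2001]
-/

open scoped Manifold ContDiff Topology RealInnerProductSpace
open Set Function Filter MeasureTheory

noncomputable section

namespace Literature.Topology.FourManifolds

universe u

/-- Local notation: `𝔼 n` is the model Euclidean space `EuclideanSpace ℝ (Fin n)`. -/
local notation "𝔼 " n:arg => EuclideanSpace ℝ (Fin n)

section Nondegenerate

variable {E : Type*} [NormedAddCommGroup E] [NormedSpace ℝ E]

/-- An injective second derivative of a `C²` function is a nondegenerate bilinear form (it is
symmetric, hence reflexive, and left-separating). [folklore] -/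
theorem nondegenerate_of_injective_fderiv_fderiv {F : E → ℝ} {z : E} (hF : ContDiffAt ℝ 2 F z)
    (hinj : Injective (fderiv ℝ (fderiv ℝ F) z)) :
    ((ContinuousLinearMap.coeLM ℝ).comp (fderiv ℝ (fderiv ℝ F) z).toLinearMap :
      LinearMap.BilinForm ℝ E).Nondegenerate := by
  set B : LinearMap.BilinForm ℝ E :=
    (ContinuousLinearMap.coeLM ℝ).comp (fderiv ℝ (fderiv ℝ F) z).toLinearMap with hB
  have hBapp : ∀ v w, B v w = fderiv ℝ (fderiv ℝ F) z v w := fun v w => rfl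
  have hsymm : B.IsSymm := ⟨fun v w => by
    rw [hBapp, hBapp]
    exact hF.isSymmSndFDerivAt (by simp) v w⟩
  have hrefl : B.IsRefl := fun v w h => by
    have := hsymm.eq v w
    rw [← this]; exact h
  rw [LinearMap.IsRefl.nondegenerate_iff_separatingLeft hrefl]
  intro v hv
  apply hinj
  rw [map_zero]
  ext w
  exact hv w

end Nondegenerate

/-! ### The embedding read in a chart is an immersion of an open subset of `ℝⁿ` -/

section Chart

variable {n N : ℕ} {M : Type*} [TopologicalSpace M] [ChartedSpace (𝔼 n) M]
  [IsManifold (𝓡 n) ∞ M] {e : M → 𝔼 N}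

/-- The embedding read in the extended chart at `x` is `C^∞` on the chart target. [folklore] -/
theorem contDiffOn_comp_extChartAt_symm (he : ContMDiff (𝓡 n) (𝓡 N) ∞ e) (x : M) :
    ContDiffOn ℝ ∞ (e ∘ (extChartAt (𝓡 n) x).symm) (extChartAt (𝓡 n) x).target :=
  contMDiffOn_iff_contDiffOn.1 (he.comp_contMDiffOn (contMDiffOn_extChartAt_symm x))

/-- The embedding read in the extended chart at `x` has injective differential on the chart
target, if `e` has injective differential everywhere. [folklore] -/
theorem injective_fderiv_comp_extChartAt_symm (he : ContMDiff (𝓡 n) (𝓡 N) ∞ e)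
    (hinj : ∀ y : M, Injective (mfderiv (𝓡 n) (𝓡 N) e y)) (x : M) {z : 𝔼 n}
    (hz : z ∈ (extChartAt (𝓡 n) x).target) :
    Injective (fderiv ℝ (e ∘ (extChartAt (𝓡 n) x).symm) z) := by
  have h1 : MDifferentiableAt 𝓘(ℝ, 𝔼 n) (𝓡 n) (extChartAt (𝓡 n) x).symm z := by
    have h := mdifferentiableWithinAt_extChartAt_symm hz
    rw [ModelWithCorners.Boundaryless.range_eq_univ] at h
    exact h.mdifferentiableAt univ_mem
  have h2 : MDifferentiableAt (𝓡 n) (𝓡 N) e ((extChartAt (𝓡 n) x).symm z) :=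
    he.mdifferentiableAt (by simp)
  have hcomp := mfderiv_comp z h2 h1
  have hinv : (mfderiv 𝓘(ℝ, 𝔼 n) (𝓡 n) (extChartAt (𝓡 n) x).symm z).IsInvertible := by
    have h := isInvertible_mfderivWithin_extChartAt_symm hz
    rwa [ModelWithCorners.Boundaryless.range_eq_univ, mfderivWithin_univ] at h
  obtain ⟨L, hL⟩ := hinv
  rw [← mfderiv_eq_fderiv, hcomp, ← hL]
  exact (hinj _).comp L.injective

end Chart

/-! ### Existence of Morse functions -/

section Existence

variable {n N : ℕ} {M : Type*} [TopologicalSpace M] [ChartedSpace (𝔼 n) M]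
  [IsManifold (𝓡 n) ∞ M] {e : M → 𝔼 N}

/-- **A good height function is a Morse function.**  If `e : M → ℝᴺ` is smooth with injective
differential and `a ∈ ℝᴺ` is such that in each chart of a cover of `M` every critical point
of `⟪a, e ∘ chart⁻¹⟫` has injective second derivative, then `x ↦ ⟪a, e x⟫` is a Morse
function on `M` (being a Morse function is local, and is checked chart by chart in
Guillemin–Pollack's proof, Ch. 1 §7). [cite: GuilleminPollack2010, Ch. 1 §7 (proof)] -/
theorem isMorse_height_of_forall (he : ContMDiff (𝓡 n) (𝓡 N) ∞ e) {t : Set M}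
    (ht : ∀ y : M, ∃ x ∈ t, y ∈ (chartAt (𝔼 n) x).source) {a : 𝔼 N}
    (ha : ∀ x ∈ t, ∀ z ∈ (extChartAt (𝓡 n) x).target,
      fderiv ℝ (HeightFunction.height (e ∘ (extChartAt (𝓡 n) x).symm) a) z = 0 →
      Injective (fderiv ℝ (fderiv ℝ
        (HeightFunction.height (e ∘ (extChartAt (𝓡 n) x).symm) a)) z)) :
    IsMorse (𝓡 n) (fun y => ⟪a, e y⟫) := by
  haveI : IsManifold (𝓡 n) 2 M := IsManifold.of_le (n := ∞) (by norm_cast)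
  set f : M → ℝ := fun y => ⟪a, e y⟫ with hf
  have hfs : ContMDiff (𝓡 n) 𝓘(ℝ, ℝ) ∞ f :=
    (InnerProductSpace.toDual ℝ (𝔼 N) a).contDiff.comp_contMDiff he
  refine ⟨hfs, fun y hy => ?_⟩
  obtain ⟨x, hxt, hyx⟩ := ht y
  have hf2 : ContMDiffAt (𝓡 n) 𝓘(ℝ, ℝ) 2 f y := (hfs.of_le (by norm_cast)) y
  have hchart : chartAt (𝔼 n) x ∈ IsManifold.maximalAtlas (𝓡 n) 2 M :=
    IsManifold.chart_mem_maximalAtlas x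
  -- read `f` in the chart at `x`: it is the height function of `e ∘ chart⁻¹`
  have hread : f ∘ ((chartAt (𝔼 n) x).extend (𝓡 n)).symm =
      HeightFunction.height (e ∘ (extChartAt (𝓡 n) x).symm) a := rfl
  have hz : (chartAt (𝔼 n) x).extend (𝓡 n) y ∈ (extChartAt (𝓡 n) x).target :=
    (extChartAt (𝓡 n) x).map_source (by rwa [extChartAt_source])
  -- critical in the chart
  have hcrit : fderiv ℝ (HeightFunction.height (e ∘ (extChartAt (𝓡 n) x).symm) a)
      ((chartAt (𝔼 n) x).extend (𝓡 n) y) = 0 := by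
    rw [← hread]
    exact (isMCriticalPt_iff_fderiv_comp_extend_symm_eq_zero hf2 hchart hyx).1 hy
  have hinj := ha x hxt _ hz hcrit
  -- nondegenerate in the chart, hence nondegenerate
  refine (nondegenerate_mhessian_iff hf2 hy hchart hyx).2 ?_
  have hF2 : ContDiffAt ℝ 2 (HeightFunction.height (e ∘ (extChartAt (𝓡 n) x).symm) a)
      ((chartAt (𝔼 n) x).extend (𝓡 n) y) :=
    ((HeightFunction.contDiffOn_height ((contDiffOn_comp_extChartAt_symm he x).of_le
      (by norm_cast)) a).contDiffAt ((isOpen_extChartAt_target x).mem_nhds hz))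
  have key := nondegenerate_of_injective_fderiv_fderiv hF2 hinj
  have hH : hessianInChart (𝓡 n) (chartAt (𝔼 n) x) f y =
      (ContinuousLinearMap.coeLM ℝ).comp (fderiv ℝ (fderiv ℝ
        (HeightFunction.height (e ∘ (extChartAt (𝓡 n) x).symm) a))
        ((chartAt (𝔼 n) x).extend (𝓡 n) y)).toLinearMap := by
    ext v w
    rw [hessianInChart_apply_apply, ModelWithCorners.Boundaryless.range_eq_univ,
      fderivWithin_univ, fderivWithin_univ, hread]
    rfl
  rw [hH]
  exact key

variable [CompactSpace M]

/-- **Almost every height function of an embedded compact manifold is a Morse function**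
(Guillemin–Pollack 1974, Ch. 1 §7; cf. Milnor 1963, §6, and Matsumoto 2001, Thm. 2.20 via
Lemma 2.21): for `e : M → ℝᴺ` smooth with injective differential on the compact manifold
`M`, for almost every `a ∈ ℝᴺ` the function `x ↦ ⟪a, e x⟫` is a Morse function. [cite: GuilleminPollack2010, Ch. 1 §7] -/
theorem ae_isMorse_height (he : ContMDiff (𝓡 n) (𝓡 N) ∞ e)
    (hinj : ∀ y : M, Injective (mfderiv (𝓡 n) (𝓡 N) e y)) :
    ∀ᵐ a ∂(volume : Measure (𝔼 N)), IsMorse (𝓡 n) (fun y => ⟪a, e y⟫) := by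
  -- finitely many charts cover `M`
  obtain ⟨t, -, ht⟩ := isCompact_univ.elim_nhds_subcover (fun x : M => (chartAt (𝔼 n) x).source)
    fun x _ => (chartAt (𝔼 n) x).open_source.mem_nhds (mem_chart_source _ x)
  have htcover : ∀ y : M, ∃ x ∈ (t : Set M), y ∈ (chartAt (𝔼 n) x).source := fun y => by
    have := ht (mem_univ y)
    simpa only [mem_iUnion, exists_prop, Finset.mem_coe] using this
  -- in each chart, almost every `a` is good
  have hgood : ∀ᵐ a ∂(volume : Measure (𝔼 N)), ∀ x ∈ (t : Set M),
      ∀ z ∈ (extChartAt (𝓡 n) x).target,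
        fderiv ℝ (HeightFunction.height (e ∘ (extChartAt (𝓡 n) x).symm) a) z = 0 →
        Injective (fderiv ℝ (fderiv ℝ
          (HeightFunction.height (e ∘ (extChartAt (𝓡 n) x).symm) a)) z) := by
    rw [ae_ball_iff t.countable_toSet]
    intro x _
    exact HeightFunction.ae_forall_injective_fderiv_fderiv_height volume
      (isOpen_extChartAt_target x)
      ((contDiffOn_comp_extChartAt_symm he x).of_le (by norm_cast))
      fun z hz => injective_fderiv_comp_extChartAt_symm he hinj x hz
  filter_upwards [hgood] with a ha
  exact isMorse_height_of_forall he htcover ha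

/-- **Discharge of the named fact `Literature.SPC4.exists_isMorse n`**: every closed smooth
`n`-manifold carries a Morse function (Morse 1934; Milnor, *Morse theory* (1963), Cor. 6.7;
Matsumoto (2001), Thm. 2.20).  Proof: Whitney embedding `e : M → ℝᴺ` (Mathlib) and a height
function `⟪a, e⟫` for `a` outside a null set (Guillemin–Pollack 1974, Ch. 1 §7). [cite: Milnor1963, Cor. 6.7] [cite: GuilleminPollack2010, Ch. 1 §7] -/
theorem exists_isMorse_holds (n : ℕ) : FourManifolds.exists_isMorse.{u} n := by
  intro M _ _ _ _ _ _
  obtain ⟨N, e, he, -, hinj⟩ := exists_embedding_euclidean_of_compact (I := 𝓡 n) (M := M)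
  haveI : (ae (volume : Measure (𝔼 N))).NeBot := ae_neBot.2 (NeZero.ne volume)
  obtain ⟨a, ha⟩ := (ae_isMorse_height he hinj).exists
  exact ⟨_, ha⟩

end Existence

end Literature.Topology.FourManifolds
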